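import Summits.AtomisticToContinuum.Crystallization.Theorems.FluxTubeKeplerFloorGivesLayered
import Summits.AtomisticToContinuum.Crystallization.Theorems.FluxTubeKeplerFluxCellKeplerSingleScale
import Summits.AtomisticToContinuum.Crystallization.Theorems.ChessboardParticlePlanesLjLaminarWindowsMinDistance

/-!
# `HardCoreRung` — F3 special-case certificate (no `sorry`)

Forward rung over `FluxTubeKepler.FloorGivesLayered` (crux dir `FluxCellKepler`, stmt-AtomisticToContinuum-15221;
fwd-rung G1 gen 11).  This file re-declares the rung family of `Lines/HardCoreRung.lean` in its own namespace
(`…HardCoreLadder.Special`, so that it never collides with the skeleton file) and proves, sorry-free: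

* `sepBudget_zero_iff` — at core `δ₀ = 0` the hard-core budget IS the floor's budget (the premise `0 ≤ dist` is
  automatic): the dial value `0` is the floor by one hypothesis move, no re-indexing;
* `sepRung_zero : SepRung 0` — **the F3 witness**: the floor's proved theorem
  `FluxTubeKeplerFloorGivesLayered.FloorGivesLayered_proof` composed with the proved `PeriodicGivenLayered_holds`,
  and the instantiation `example : SepRung 0 := by simpa [SepRung] using sepRung_zero`;
* `sepRung_anti` — the dial is monotone (a larger core is a weaker hypothesis, so the rung with the larger core is
  the stronger statement); `sepRung_zero_of_hardCoreRung` — the rung gives back the floor;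
* `sepRung_seven_tenths : SepRung (7/10)` and `sepRung_of_le_seven_tenths` — **the proved range of the dial**: with
  the tree's hard core `7/10` for Lennard-Jones ground states (`LjLaminarWindowsSketch.stub_minDistance07`, landed,
  sharpening Yuhjtman 2015 Cor. 7) every core `δ₀ ≤ 7/10` is floor-regime; the deciding rung `SepRung (3/4)` is the
  next value.
-/

noncomputable section

namespace Summit.AtomisticToContinuum.Crystallization.Cruxes.FluxCellKepler.HardCoreLadder.Special

open Filter Topology
open Literature.MathematicalPhysics.StatisticalMechanics
open Summit.AtomisticToContinuum.Crystallization.Theorems.FluxCellKeplerSingleScale (LayeredGood)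

local notation "E3" => EuclideanSpace ℝ (Fin 3)

/-- FLOOR(P₀) (verbatim the first hypothesis of `FluxTubeKepler.FloorGivesLayered`). -/
def Floor (P₀ : PeriodicConfiguration 3) : Prop :=
  ∀ (N : ℕ) (x : Fin N → E3), IsGroundState lennardJones x →
    (N : ℝ) * P₀.energyPerParticle lennardJones ≤ interactionEnergy lennardJones x

/-- HARD-CORE BUDGET with core `δ₀` (verbatim `Lines/HardCoreRung.lean`). -/
def SepBudget (δ₀ : ℝ) (P₀ : PeriodicConfiguration 3) : Prop :=
  ∀ R η : ℝ, 0 < R → 0 < η → ∃ c : ℝ, 0 < c ∧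
    ∀ (N : ℕ) (x : Fin N → E3), IsGroundState lennardJones x →
      (∀ i j : Fin N, i ≠ j → δ₀ ≤ dist (x i) (x j)) →
      c * (Nat.card {i : Fin N // ¬ LayeredGood R η x i} : ℝ) ≤
        interactionEnergy lennardJones x - (N : ℝ) * P₀.energyPerParticle lennardJones

/-- Periodic windows along the sequence (verbatim). -/
def HasPeriodicWindows (x : (N : ℕ) → (Fin N → E3)) : Prop :=
  ∃ P : PeriodicConfiguration 3, ∀ R ε : ℝ, 0 < ε → ∃ᶠ N in atTop, ∃ t : E3,
    (∀ q ∈ P.points, ‖q‖ ≤ R → ∃ i : Fin N, dist (x N i + t) q ≤ ε) ∧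
    (∀ i : Fin N, ‖x N i + t‖ ≤ R → ∃ q ∈ P.points, dist (x N i + t) q ≤ ε)

/-- The graded family (verbatim). -/
def SepRung (δ₀ : ℝ) : Prop :=
  ∀ P₀ : PeriodicConfiguration 3, Floor P₀ → SepBudget δ₀ P₀ →
    ∀ x : (N : ℕ) → (Fin N → E3), (∀ N, IsGroundState lennardJones (x N)) → HasPeriodicWindows x

/-- The deciding rung (verbatim). -/
def HardCoreRung : Prop := SepRung (3 / 4)

/-- The pointwise hard core `δ₀` of Lennard-Jones ground states (verbatim). -/
def MinDist (δ₀ : ℝ) : Prop :=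
  ∀ (N : ℕ) (x : Fin N → E3), IsGroundState lennardJones x → ∀ i j : Fin N, i ≠ j → δ₀ ≤ dist (x i) (x j)

/-- At core `0` the hard-core budget IS the floor's budget. -/
theorem sepBudget_zero_iff (P₀ : PeriodicConfiguration 3) :
    SepBudget 0 P₀ ↔
      ∀ R η : ℝ, 0 < R → 0 < η → ∃ c : ℝ, 0 < c ∧
        ∀ (N : ℕ) (x : Fin N → E3), IsGroundState lennardJones x →
          c * (Nat.card {i : Fin N // ¬ LayeredGood R η x i} : ℝ) ≤
            interactionEnergy lennardJones x - (N : ℝ) * P₀.energyPerParticle lennardJones := by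
  refine forall₄_congr fun R η _ _ => exists_congr fun c => and_congr_right fun _ =>
    forall₃_congr fun N x _ => ?_
  exact ⟨fun h => h fun i j _ => dist_nonneg, fun h _ => h⟩

/-- **F3 witness.** `SepRung 0` is the floor: `FloorGivesLayered_proof` then `PeriodicGivenLayered_holds`. -/
theorem sepRung_zero : SepRung 0 := fun P₀ hF hB x hx =>
  Theses.FluxTubeKepler.PeriodicGivenLayered_holds x hx
    (Theorems.FluxTubeKeplerFloorGivesLayered.FloorGivesLayered_proof P₀ hF
      ((sepBudget_zero_iff P₀).1 hB) x hx)

/-- The F3 instantiation in `example` form: the dial member at the floor's parameter, from the floor. -/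
example : SepRung 0 := by
  simpa [SepRung] using sepRung_zero

/-- A larger hard core is a weaker budget hypothesis. -/
theorem sepBudget_mono {δ₀ δ₁ : ℝ} (h : δ₀ ≤ δ₁) {P₀ : PeriodicConfiguration 3} :
    SepBudget δ₀ P₀ → SepBudget δ₁ P₀ := by
  intro hB R η hR hη
  obtain ⟨c, hc, hcN⟩ := hB R η hR hη
  exact ⟨c, hc, fun N x hx hsep => hcN N x hx fun i j hij => h.trans (hsep i j hij)⟩

/-- `SepRung` is monotone in the core. -/
theorem sepRung_anti {δ₀ δ₁ : ℝ} (h : δ₀ ≤ δ₁) : SepRung δ₁ → SepRung δ₀ :=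
  fun H P₀ hF hB x hx => H P₀ hF (sepBudget_mono h hB) x hx

/-- The deciding rung gives back the floor member. -/
theorem sepRung_zero_of_hardCoreRung (h : HardCoreRung) : SepRung 0 :=
  sepRung_anti (by norm_num) h

/-- **Transfer.** A hard core `δ₀` for ground states makes the hard-core premise automatic: `MinDist δ₀ → SepRung δ₀`. -/
theorem sepRung_of_minDist {δ₀ : ℝ} (hmd : MinDist δ₀) : SepRung δ₀ := fun P₀ hF hB x hx =>
  sepRung_zero P₀ hF ((sepBudget_zero_iff P₀).2 fun R η hR hη => by
    obtain ⟨c, hc, h⟩ := hB R η hR hη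
    exact ⟨c, hc, fun N y hy => h N y hy (hmd N y hy)⟩) x hx

/-- The tree's hard core: every Lennard-Jones ground state is `7/10`-separated (landed
`LjLaminarWindowsSketch.stub_minDistance07`, sharpening Yuhjtman 2015, Cor. 7). -/
theorem minDist_seven_tenths : MinDist (7 / 10) := fun N x hx i j hij =>
  Theorems.LjLaminarWindowsSketch.stub_minDistance07 N x hx i j hij

/-- **Proved range of the dial.** `SepRung (7/10)` holds — the floor conditioned on the tree's hard core. -/
theorem sepRung_seven_tenths : SepRung (7 / 10) := sepRung_of_minDist minDist_seven_tenths

/-- Every core `δ₀ ≤ 7/10` is floor-regime; the deciding rung `SepRung (3/4)` is the next value. -/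
theorem sepRung_of_le_seven_tenths {δ₀ : ℝ} (h : δ₀ ≤ 7 / 10) : SepRung δ₀ :=
  sepRung_anti h sepRung_seven_tenths

end Summit.AtomisticToContinuum.Crystallization.Cruxes.FluxCellKepler.HardCoreLadder.Special

end
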